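import Literature.NumberTheory.Automorphic.ArchLocalTorusOrbitalDeriv         -- FILE A′ (this brick): `C¹` along one-angle curves on the block-separated set
import Literature.NumberTheory.Automorphic.ArchTorusOrbitalWeyl               -- ★ p839748 (V2)-W: `integral_comp_conj_circleDiagonal_comp_perm` (Weyl invariance, per place)
import Mathlib.Analysis.SpecialFunctions.Trigonometric.Deriv
import HarnessLib

/-!
# (J-cw): across a COMPACT WALL of `G_w = U(σ_w diag α)(ℂ)` (`N = 3`) the torus orbital function is even and `C¹`, and `∂_ψ(2 sin ψ · F(z_ψ)) → 2·F(z₀)`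
# (ROAD-Sd census clause (J-cw); Rogawski 1990 §8.2 p. 123: the «`−2cF′(γ₀′)`» term at the compact inner form, with OUR constant explicit)

Topic `NumberTheory/Automorphic`; namespace `Literature.NumberTheory.Automorphic.UnitaryGroup`.  THEOREMS ONLY (no `def`, no instance, no notation, no axiom, no named
fact, no `sorry`).  Cell `pub/hodgecm-mathlib`, ENGINE T1 (crux H413 = `stmt-HodgeConjecture-24833`); floor-1 preparation, count-neutral, under books rows #111 (S-d) ∕ #88
(ST-∞): ROAD-Sd map of record `CENSUS-ROAD-Sd-letters` (3ec10e9b) clause **(J-cw) «compact wall: `C¹` and even across the wall, `deriv g_Θ → 2·F_Θ(z₀)`»** (LEAD DESK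
WORD T8-15 (C), F0P3a-plan (g9), 2026-09-01); author F0P3a-p06 (g10); per place (desk ruling T6-84 (V7)); FILE B′ over FILE A′ `ArchLocalTorusOrbitalDeriv` (differentiation
under the integral on the block-separated set, ★ (C-cw) domination p839953) and ★ (V2)-W `ArchTorusOrbitalWeyl` (p839748).

SETTING (`N = 3`).  `G_w = archLocal L 3 (diagonal α) w`, `e_i = re σ_w(α_i)` real non-zero; THE COMPACT WALL: base point `z₀ : Fin 3 → S¹` with `z₀ 0 = z₀ 2` (ON the wall),
`z₀ 0 ≠ z₀ 1`, and `0 < e_0 e_2` (the coalescing pair spans a DEFINITE plane: centraliser `U(2) × U(1)`, print's `γ₀′`); THE SPLIT CURVE `z_ψ = (z₀₀e^{iψ}, z₀₁, z₀₀e^{−iψ})`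
(★ (V4), weights `c = (1, 0, −1)`); `F_Θ(z) = ∫_{G_w} Θ(↑↑(g·t_w(z)·g⁻¹)) dν(g)` for `Θ : M_3(ℂ) → E` (`C¹`, compact support on `G_w`, `Matrix.Norms.Operator`), and print's
normalised function `g_Θ(ψ) = 2 sin ψ · F_Θ(z_ψ)`.

WHAT IS PROVED.
* §1 `splitCurve_neg_eq_comp_swap` (`z_{−ψ} = z_ψ ∘ (0 2)`), **`integral_comp_conj_circleDiagonal_splitCurve_neg`** — `F_Θ(z_{−ψ}) = F_Θ(z_ψ)` for EVERY
  `Θ` and every right-invariant `ν` (the transposition `(0 2)` is ADMISSIBLE at a compact pair: ★ `integral_comp_conj_circleDiagonal_comp_perm`).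
* §2 `splitCurve_blockSeparated_zero`, `isOpen_setOf_splitCurve_blockSeparated`, **`contDiffOn_one_integral_comp_conj_splitCurve_compactWall`** (`F_Θ ∘ z` is `C¹` on the open
  set `{ψ | z_ψ 0 ≠ z_ψ 1 ∧ z_ψ 1 ≠ z_ψ 2} ∋ 0` — FILE A′ with the wall labelling `(0, 1, 0)`), `hasDerivAt_integral_comp_conj_splitCurve_zero` and
  **`deriv_integral_comp_conj_splitCurve_zero : deriv (F_Θ ∘ z) 0 = 0`** (even and differentiable at `0`).
* §3 **`hasDerivAt_sin_smul_integral_compactWall_zero`** — `g_Θ` has derivative `2 • F_Θ(z₀)` at `ψ = 0`; **`tendsto_deriv_sin_smul_integral_compactWall`** —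
  `Tendsto (fun ψ => deriv g_Θ ψ) (𝓝 0) (𝓝 ((2 : ℝ) • F_Θ z₀))` (`g_Θ` is `C¹` near `0`, so `deriv g_Θ` is continuous at `0`): the compact-wall companion of the LETTER (J-nc)
  (there `𝓝[≠] 0` and a printed constant `c`; here the two-sided limit exists through `0` and the constant is `2`).
NOT HERE: the noncompact wall ((J-nc), LETTER — properness and evenness both FAIL there); the descended form `F_Θ(z₀) = ν_H(H_w)⁻¹ · ∫_{G_w∕H_w}` by the compact centraliser
(★ D1′c `integral_quotientMeasure_eq_inv_smul`, a one-line rider for the consumer).  HONEST LABEL: real analysis on a real group; HC_CM is proved only modulo the printed citations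
until rung 0 closes, and this file pays nothing by itself.

## References
* [Rogawski1990] J. D. Rogawski, *Automorphic Representations of Unitary Groups in Three Variables*, Ann. of Math. Stud. 123 (1990), §8.2 pp. 122–123 («as `ψ → 0` … `γ₂`
  approaches `γ₀′` whose centralizer `H′` is the compact inner form of `H`»; `lim_{ψ→0+} ∂_ψ(|2 sin ψ|·Φ_{H′}(γ₂, F′)) = −2cF′(γ₀′)`), §3.1 p. 19.
* [Shelstad1979] D. Shelstad, *Characters and inner forms of a quasi-split group over ℝ*, Compositio Math. 39 (1979), §4.
* [Varadarajan1989] V. S. Varadarajan, *An Introduction to Harmonic Analysis on Semisimple Lie Groups* (1989), §2.4 Thm. 8 (compact case: `F_f` smooth on the whole torus).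
* [Folland1995] G. B. Folland, *A Course in Abstract Harmonic Analysis* (1995), §2.6.
-/

set_option autoImplicit false

noncomputable section

open MeasureTheory Measure NumberField NumberField.InfinitePlace Filter Topology Set
open scoped Matrix MatrixGroups Real
open scoped Matrix.Norms.Operator

namespace Literature.NumberTheory.Automorphic.UnitaryGroup

/-! ## §1 Evenness across the compact wall -/

/-- **The reflected split curve is the relabelled split curve**: for `z₀ 0 = z₀ 2`, `z_{−ψ} = z_ψ ∘ (0 2)`. [cite: Rogawski1990, §8.2 p. 122] -/
theorem splitCurve_neg_eq_comp_swap {z₀ : Fin 3 → Circle} (h02 : z₀ 0 = z₀ 2) (ψ : ℝ) :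
    (fun i => z₀ i * Circle.exp (![(1 : ℝ), 0, -1] i * -ψ)) = (fun i => z₀ i * Circle.exp (![(1 : ℝ), 0, -1] i * ψ)) ∘ Equiv.swap (0 : Fin 3) 2 := by
  funext i
  fin_cases i
  · simp [h02, Equiv.swap_apply_left]
  · simp [Equiv.swap_apply_of_ne_of_ne]
  · simp [h02, Equiv.swap_apply_right]

section Wall

variable (L : Type) [Field L] (α : Fin 3 → L) (w : {w : InfinitePlace L // IsComplex w})
  [MeasurableSpace (archLocal L 3 (Matrix.diagonal α) w)] [BorelSpace (archLocal L 3 (Matrix.diagonal α) w)]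
  {E : Type*} [NormedAddCommGroup E] [NormedSpace ℝ E]

/-- **EVENNESS OF THE TORUS ORBITAL FUNCTION ACROSS A COMPACT WALL**: `F(z_{−ψ}) = F(z_ψ)` for EVERY `f : G_w → E` and every right-invariant `ν`, at a base point
`z₀ 0 = z₀ 2` of a place where `e_0 e_2 > 0` — the transposition `(0 2)` preserves the sign pattern, so ★ (V2)-W `integral_comp_conj_circleDiagonal_comp_perm` applies.
(At a NONCOMPACT wall `(0 2)` is not admissible and the function JUMPS — LETTER (J-nc).) [cite: Rogawski1990, §8.2 pp. 122–123] [cite: Shelstad1979, §4] -/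
theorem integral_comp_conj_circleDiagonal_splitCurve_neg (hα : ∀ i, α i ≠ 0) (hreal : ∀ i, (w.1.embedding (α i)).im = 0)
    (h02e : 0 < (w.1.embedding (α 0)).re * (w.1.embedding (α 2)).re) {z₀ : Fin 3 → Circle} (h02 : z₀ 0 = z₀ 2)
    (ν : Measure (archLocal L 3 (Matrix.diagonal α) w)) [ν.IsMulRightInvariant] (f : archLocal L 3 (Matrix.diagonal α) w → E) (ψ : ℝ) :
    ∫ g, f (g * ⟨circleDiagonal 3 fun i => z₀ i * Circle.exp (![(1 : ℝ), 0, -1] i * -ψ), circleDiagonal_mem_archLocal_diagonal L 3 α w _⟩ * g⁻¹) ∂ν =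
      ∫ g, f (g * ⟨circleDiagonal 3 fun i => z₀ i * Circle.exp (![(1 : ℝ), 0, -1] i * ψ), circleDiagonal_mem_archLocal_diagonal L 3 α w _⟩ * g⁻¹) ∂ν := by
  -- same sign of `e_0`, `e_2` (★ `Literature.Topology.Immersions.pos_iff_pos_of_mul_pos` states this too; three lines here to avoid the import)
  have hiff : (0 < (w.1.embedding (α 0)).re ↔ 0 < (w.1.embedding (α 2)).re) := by
    rcases pos_and_pos_or_neg_and_neg_of_mul_pos h02e with ⟨ha, hb⟩ | ⟨ha, hb⟩
    · exact ⟨fun _ => hb, fun _ => ha⟩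
    · exact ⟨fun h' => absurd h' (not_lt.mpr ha.le), fun h' => absurd h' (not_lt.mpr hb.le)⟩
  have hsign : ∀ i : Fin 3, 0 < (w.1.embedding (α (Equiv.swap (0 : Fin 3) 2 i))).re ↔ 0 < (w.1.embedding (α i)).re := by
    intro i
    fin_cases i
    · exact hiff.symm
    · rw [Equiv.swap_apply_of_ne_of_ne (by decide) (by decide)]
    · exact hiff
  rw [splitCurve_neg_eq_comp_swap h02 ψ]
  exact integral_comp_conj_circleDiagonal_comp_perm L 3 α w hα hreal hsign _ ν f

/-! ## §2 `C¹` through the wall and the vanishing derivative at the wall -/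

/-- At `ψ = 0` the split curve sits at `z₀`, which is BLOCK-SEPARATED for the wall labelling `(0, 1, 0)` as soon as `z₀ 0 ≠ z₀ 1` (and `z₀ 1 ≠ z₀ 2`).
[cite: Rogawski1990, §8.2 p. 122] -/
theorem splitCurve_blockSeparated_zero {z₀ : Fin 3 → Circle} (h01 : z₀ 0 ≠ z₀ 1) (h12 : z₀ 1 ≠ z₀ 2) :
    ∀ i j : Fin 3, (![(0 : ℕ), 1, 0]) i ≠ (![(0 : ℕ), 1, 0]) j →
      z₀ i * Circle.exp (![(1 : ℝ), 0, -1] i * (0 : ℝ)) ≠ z₀ j * Circle.exp (![(1 : ℝ), 0, -1] j * (0 : ℝ)) := by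
  intro i j hb
  have h := blockSeparated_of_ne h01 h12 i j hb
  simpa only [mul_zero, Circle.exp_zero, mul_one] using h

/-- The set of parameters where the split curve is block-separated is open and contains `0`. [cite: Rogawski1990, §3.1 p. 19] -/
theorem isOpen_setOf_splitCurve_blockSeparated (z₀ : Fin 3 → Circle) :
    IsOpen {ψ : ℝ | ∀ i j : Fin 3, (![(0 : ℕ), 1, 0]) i ≠ (![(0 : ℕ), 1, 0]) j →
      z₀ i * Circle.exp (![(1 : ℝ), 0, -1] i * ψ) ≠ z₀ j * Circle.exp (![(1 : ℝ), 0, -1] j * ψ)} :=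
  (isOpen_setOf_blockSeparated (![(0 : ℕ), 1, 0])).preimage (continuous_torusCurve z₀ _)

variable (ν : Measure (archLocal L 3 (Matrix.diagonal α) w)) [IsFiniteMeasureOnCompacts ν]

/-- **`F_Θ ∘ z` IS `C¹` ON AN OPEN SET CONTAINING THE WALL PARAMETER `ψ = 0`** (FILE A′ `contDiffOn_one_…_of_blocks` with the wall labelling `(0, 1, 0)`; `0 < e_0 e_2`).
[cite: Rogawski1990, §8.2 pp. 122–123] [cite: Varadarajan1989, §2.4 Thm. 8] -/
theorem contDiffOn_one_integral_comp_conj_splitCurve_compactWall (hα : ∀ i, α i ≠ 0) (hreal : ∀ i, (w.1.embedding (α i)).im = 0)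
    (h02e : 0 < (w.1.embedding (α 0)).re * (w.1.embedding (α 2)).re)
    (Θ : Matrix (Fin 3) (Fin 3) ℂ → E) (hΘ : ContDiff ℝ 1 Θ)
    (hfc : HasCompactSupport fun k : archLocal L 3 (Matrix.diagonal α) w => Θ (((k : GL (Fin 3) ℂ) : Matrix (Fin 3) (Fin 3) ℂ))) (z₀ : Fin 3 → Circle) :
    ContDiffOn ℝ 1 (fun ψ : ℝ => ∫ g : archLocal L 3 (Matrix.diagonal α) w,
        Θ ((((g * ⟨circleDiagonal 3 fun i => z₀ i * Circle.exp (![(1 : ℝ), 0, -1] i * ψ), circleDiagonal_mem_archLocal_diagonal L 3 α w _⟩ * g⁻¹ :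
          archLocal L 3 (Matrix.diagonal α) w) : GL (Fin 3) ℂ) : Matrix (Fin 3) (Fin 3) ℂ)) ∂ν)
      {ψ : ℝ | ∀ i j : Fin 3, (![(0 : ℕ), 1, 0]) i ≠ (![(0 : ℕ), 1, 0]) j →
        z₀ i * Circle.exp (![(1 : ℝ), 0, -1] i * ψ) ≠ z₀ j * Circle.exp (![(1 : ℝ), 0, -1] j * ψ)} :=
  contDiffOn_one_integral_comp_conj_circleDiagonal_curve_of_blocks L 3 α w hα hreal (![(0 : ℕ), 1, 0]) (sign_of_wallLabel L α w h02e) ν Θ hΘ hfc z₀ _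

/-- **`F_Θ ∘ z` IS DIFFERENTIABLE AT THE WALL PARAMETER** with the derivative under the integral sign (FILE A′). [cite: Rogawski1990, §8.2 pp. 122–123] -/
theorem hasDerivAt_integral_comp_conj_splitCurve_zero (hα : ∀ i, α i ≠ 0) (hreal : ∀ i, (w.1.embedding (α i)).im = 0)
    (h02e : 0 < (w.1.embedding (α 0)).re * (w.1.embedding (α 2)).re)
    (Θ : Matrix (Fin 3) (Fin 3) ℂ → E) (hΘ : ContDiff ℝ 1 Θ)
    (hfc : HasCompactSupport fun k : archLocal L 3 (Matrix.diagonal α) w => Θ (((k : GL (Fin 3) ℂ) : Matrix (Fin 3) (Fin 3) ℂ)))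
    {z₀ : Fin 3 → Circle} (h01 : z₀ 0 ≠ z₀ 1) (h12 : z₀ 1 ≠ z₀ 2) :
    HasDerivAt (fun ψ : ℝ => ∫ g : archLocal L 3 (Matrix.diagonal α) w,
        Θ ((((g * ⟨circleDiagonal 3 fun i => z₀ i * Circle.exp (![(1 : ℝ), 0, -1] i * ψ), circleDiagonal_mem_archLocal_diagonal L 3 α w _⟩ * g⁻¹ :
          archLocal L 3 (Matrix.diagonal α) w) : GL (Fin 3) ℂ) : Matrix (Fin 3) (Fin 3) ℂ)) ∂ν)
      (∫ g : archLocal L 3 (Matrix.diagonal α) w,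
        fderiv ℝ Θ ((((g * ⟨circleDiagonal 3 fun i => z₀ i * Circle.exp (![(1 : ℝ), 0, -1] i * (0 : ℝ)), circleDiagonal_mem_archLocal_diagonal L 3 α w _⟩ * g⁻¹ :
            archLocal L 3 (Matrix.diagonal α) w) : GL (Fin 3) ℂ) : Matrix (Fin 3) (Fin 3) ℂ))
          (((g : GL (Fin 3) ℂ) : Matrix (Fin 3) (Fin 3) ℂ) *
            (Matrix.diagonal fun i => (z₀ i : ℂ) * (Complex.exp ((![(1 : ℝ), 0, -1] i * (0 : ℝ) : ℝ) * Complex.I) * ((![(1 : ℝ), 0, -1] i : ℂ) * Complex.I))) *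
            (((g⁻¹ : archLocal L 3 (Matrix.diagonal α) w) : GL (Fin 3) ℂ) : Matrix (Fin 3) (Fin 3) ℂ)) ∂ν) 0 :=
  (hasDerivAt_integral_comp_conj_circleDiagonal_curve_of_blocks L 3 α w hα hreal (![(0 : ℕ), 1, 0]) (sign_of_wallLabel L α w h02e) ν Θ hΘ hfc z₀ _ 0
    (splitCurve_blockSeparated_zero h01 h12)).2

/-- **THE DERIVATIVE AT THE WALL VANISHES**: `deriv (F_Θ ∘ z) 0 = 0` — `F_Θ ∘ z` is even (§1) and differentiable at `0` (§2). [cite: Rogawski1990, §8.2 p. 123]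
[cite: Varadarajan1989, §2.4 Thm. 8] -/
theorem deriv_integral_comp_conj_splitCurve_zero (hα : ∀ i, α i ≠ 0) (hreal : ∀ i, (w.1.embedding (α i)).im = 0)
    (h02e : 0 < (w.1.embedding (α 0)).re * (w.1.embedding (α 2)).re) [ν.IsMulRightInvariant]
    (Θ : Matrix (Fin 3) (Fin 3) ℂ → E) (hΘ : ContDiff ℝ 1 Θ)
    (hfc : HasCompactSupport fun k : archLocal L 3 (Matrix.diagonal α) w => Θ (((k : GL (Fin 3) ℂ) : Matrix (Fin 3) (Fin 3) ℂ)))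
    {z₀ : Fin 3 → Circle} (h02 : z₀ 0 = z₀ 2) (h01 : z₀ 0 ≠ z₀ 1) :
    deriv (fun ψ : ℝ => ∫ g : archLocal L 3 (Matrix.diagonal α) w,
        Θ ((((g * ⟨circleDiagonal 3 fun i => z₀ i * Circle.exp (![(1 : ℝ), 0, -1] i * ψ), circleDiagonal_mem_archLocal_diagonal L 3 α w _⟩ * g⁻¹ :
          archLocal L 3 (Matrix.diagonal α) w) : GL (Fin 3) ℂ) : Matrix (Fin 3) (Fin 3) ℂ)) ∂ν) 0 = 0 := by
  have h12 : z₀ 1 ≠ z₀ 2 := fun h => h01 (h02.trans h.symm)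
  -- the function, its evenness and its derivative at `0`
  obtain ⟨G, hG⟩ : ∃ G : ℝ → E, G = fun ψ : ℝ => ∫ g : archLocal L 3 (Matrix.diagonal α) w,
      Θ ((((g * ⟨circleDiagonal 3 fun i => z₀ i * Circle.exp (![(1 : ℝ), 0, -1] i * ψ), circleDiagonal_mem_archLocal_diagonal L 3 α w _⟩ * g⁻¹ :
        archLocal L 3 (Matrix.diagonal α) w) : GL (Fin 3) ℂ) : Matrix (Fin 3) (Fin 3) ℂ)) ∂ν := ⟨_, rfl⟩
  have heven : (G ∘ fun ψ : ℝ => -ψ) = G := by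
    funext ψ
    rw [Function.comp_apply, hG]
    exact integral_comp_conj_circleDiagonal_splitCurve_neg L α w hα hreal h02e h02 ν
      (fun k : archLocal L 3 (Matrix.diagonal α) w => Θ (((k : GL (Fin 3) ℂ) : Matrix (Fin 3) (Fin 3) ℂ))) ψ
  have hd : HasDerivAt G (deriv G 0) 0 := by
    rw [hG]
    exact (hasDerivAt_integral_comp_conj_splitCurve_zero L α w ν hα hreal h02e Θ hΘ hfc h01 h12).differentiableAt.hasDerivAt
  -- `G ∘ neg` has derivative `−G′(0)` at `0`; but `G ∘ neg = G`
  have hneg : HasDerivAt (G ∘ fun ψ : ℝ => -ψ) ((-1 : ℝ) • deriv G 0) 0 := by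
    have h0 : HasDerivAt G (deriv G 0) ((fun ψ : ℝ => -ψ) 0) := by simp only [neg_zero]; exact hd
    exact h0.scomp 0 (hasDerivAt_neg' (0 : ℝ))
  rw [heven] at hneg
  have h2 : deriv G 0 = (-1 : ℝ) • deriv G 0 := hd.unique hneg
  rw [neg_one_smul, eq_neg_iff_add_eq_zero, ← two_smul ℝ] at h2
  rw [← hG]
  exact (smul_eq_zero.mp h2).resolve_left two_ne_zero

/-! ## §3 Print's normalised function `g_Θ(ψ) = 2 sin ψ · F_Θ(z_ψ)`: `∂_ψ g_Θ → 2 · F_Θ(z₀)` through the compact wall -/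

/-- **`g_Θ` HAS DERIVATIVE `2 • F_Θ(z₀)` AT THE WALL** (product rule: `2 cos 0 • F_Θ(z₀) + 2 sin 0 • (F_Θ ∘ z)′(0)`). [cite: Rogawski1990, §8.2 p. 123]
[cite: Varadarajan1989, §2.4 Thm. 8] -/
theorem hasDerivAt_sin_smul_integral_compactWall_zero (hα : ∀ i, α i ≠ 0) (hreal : ∀ i, (w.1.embedding (α i)).im = 0)
    (h02e : 0 < (w.1.embedding (α 0)).re * (w.1.embedding (α 2)).re)
    (Θ : Matrix (Fin 3) (Fin 3) ℂ → E) (hΘ : ContDiff ℝ 1 Θ)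
    (hfc : HasCompactSupport fun k : archLocal L 3 (Matrix.diagonal α) w => Θ (((k : GL (Fin 3) ℂ) : Matrix (Fin 3) (Fin 3) ℂ)))
    {z₀ : Fin 3 → Circle} (h01 : z₀ 0 ≠ z₀ 1) (h12 : z₀ 1 ≠ z₀ 2) :
    HasDerivAt (fun ψ : ℝ => (2 * Real.sin ψ) • ∫ g : archLocal L 3 (Matrix.diagonal α) w,
        Θ ((((g * ⟨circleDiagonal 3 fun i => z₀ i * Circle.exp (![(1 : ℝ), 0, -1] i * ψ), circleDiagonal_mem_archLocal_diagonal L 3 α w _⟩ * g⁻¹ :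
          archLocal L 3 (Matrix.diagonal α) w) : GL (Fin 3) ℂ) : Matrix (Fin 3) (Fin 3) ℂ)) ∂ν)
      ((2 : ℝ) • ∫ g : archLocal L 3 (Matrix.diagonal α) w,
        Θ ((((g * ⟨circleDiagonal 3 z₀, circleDiagonal_mem_archLocal_diagonal L 3 α w z₀⟩ * g⁻¹ :
          archLocal L 3 (Matrix.diagonal α) w) : GL (Fin 3) ℂ) : Matrix (Fin 3) (Fin 3) ℂ)) ∂ν) 0 := by
  have hG := hasDerivAt_integral_comp_conj_splitCurve_zero L α w ν hα hreal h02e Θ hΘ hfc h01 h12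
  have hs : HasDerivAt (fun ψ : ℝ => 2 * Real.sin ψ) (2 * Real.cos 0) 0 := (Real.hasDerivAt_sin 0).const_mul 2
  have h := hs.smul hG
  simp only [Real.sin_zero, Real.cos_zero, mul_zero, zero_smul, zero_add, mul_one, Circle.exp_zero] at h
  exact h

/-- **THROUGH A COMPACT WALL, `lim_{ψ→0} ∂_ψ(2 sin ψ · F_Θ(z_ψ)) = 2 · F_Θ(z₀)`** — the two-sided limit EXISTS and the constant is `2` (times the mass normalisation hidden in `ν`):
`g_Θ` is `C¹` on an open set around `0` (§2 and the smoothness of `sin`), so `deriv g_Θ` is continuous at `0` with value `2 • F_Θ(z₀)` (previous theorem).  This is the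
compact-wall companion of the LETTER (J-nc) (Harish-Chandra's limit formula at a NONCOMPACT wall, `𝓝[≠] 0`, printed constant `c`); print's sign discussion
«the constant for `H′` differs by a sign from that for `H`» compares exactly these two. [cite: Rogawski1990, §8.2 p. 123] [cite: Varadarajan1989, §2.4 Thm. 8] -/
theorem tendsto_deriv_sin_smul_integral_compactWall (hα : ∀ i, α i ≠ 0) (hreal : ∀ i, (w.1.embedding (α i)).im = 0)
    (h02e : 0 < (w.1.embedding (α 0)).re * (w.1.embedding (α 2)).re)
    (Θ : Matrix (Fin 3) (Fin 3) ℂ → E) (hΘ : ContDiff ℝ 1 Θ)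
    (hfc : HasCompactSupport fun k : archLocal L 3 (Matrix.diagonal α) w => Θ (((k : GL (Fin 3) ℂ) : Matrix (Fin 3) (Fin 3) ℂ)))
    {z₀ : Fin 3 → Circle} (h01 : z₀ 0 ≠ z₀ 1) (h12 : z₀ 1 ≠ z₀ 2) :
    Tendsto (fun ψ : ℝ => deriv (fun ψ : ℝ => (2 * Real.sin ψ) • ∫ g : archLocal L 3 (Matrix.diagonal α) w,
        Θ ((((g * ⟨circleDiagonal 3 fun i => z₀ i * Circle.exp (![(1 : ℝ), 0, -1] i * ψ), circleDiagonal_mem_archLocal_diagonal L 3 α w _⟩ * g⁻¹ :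
          archLocal L 3 (Matrix.diagonal α) w) : GL (Fin 3) ℂ) : Matrix (Fin 3) (Fin 3) ℂ)) ∂ν) ψ)
      (𝓝 0) (𝓝 ((2 : ℝ) • ∫ g : archLocal L 3 (Matrix.diagonal α) w,
        Θ ((((g * ⟨circleDiagonal 3 z₀, circleDiagonal_mem_archLocal_diagonal L 3 α w z₀⟩ * g⁻¹ :
          archLocal L 3 (Matrix.diagonal α) w) : GL (Fin 3) ℂ) : Matrix (Fin 3) (Fin 3) ℂ)) ∂ν)) := by
  -- `g_Θ` is `C¹` on the open block-separated parameter set `U ∋ 0`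
  have hU := isOpen_setOf_splitCurve_blockSeparated z₀
  have h0U : (0 : ℝ) ∈ {ψ : ℝ | ∀ i j : Fin 3, (![(0 : ℕ), 1, 0]) i ≠ (![(0 : ℕ), 1, 0]) j →
      z₀ i * Circle.exp (![(1 : ℝ), 0, -1] i * ψ) ≠ z₀ j * Circle.exp (![(1 : ℝ), 0, -1] j * ψ)} := splitCurve_blockSeparated_zero h01 h12
  have hGc1 := contDiffOn_one_integral_comp_conj_splitCurve_compactWall L α w ν hα hreal h02e Θ hΘ hfc z₀
  have hsin : ContDiffOn ℝ 1 (fun ψ : ℝ => 2 * Real.sin ψ) {ψ : ℝ | ∀ i j : Fin 3, (![(0 : ℕ), 1, 0]) i ≠ (![(0 : ℕ), 1, 0]) j →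
      z₀ i * Circle.exp (![(1 : ℝ), 0, -1] i * ψ) ≠ z₀ j * Circle.exp (![(1 : ℝ), 0, -1] j * ψ)} :=
    (contDiff_const.mul Real.contDiff_sin).contDiffOn
  have hg1 := hsin.smul hGc1
  have hfun : ((fun ψ : ℝ => 2 * Real.sin ψ) • fun ψ : ℝ => ∫ g : archLocal L 3 (Matrix.diagonal α) w,
      Θ ((((g * ⟨circleDiagonal 3 fun i => z₀ i * Circle.exp (![(1 : ℝ), 0, -1] i * ψ), circleDiagonal_mem_archLocal_diagonal L 3 α w _⟩ * g⁻¹ :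
        archLocal L 3 (Matrix.diagonal α) w) : GL (Fin 3) ℂ) : Matrix (Fin 3) (Fin 3) ℂ)) ∂ν) =
      fun ψ : ℝ => (2 * Real.sin ψ) • ∫ g : archLocal L 3 (Matrix.diagonal α) w,
        Θ ((((g * ⟨circleDiagonal 3 fun i => z₀ i * Circle.exp (![(1 : ℝ), 0, -1] i * ψ), circleDiagonal_mem_archLocal_diagonal L 3 α w _⟩ * g⁻¹ :
          archLocal L 3 (Matrix.diagonal α) w) : GL (Fin 3) ℂ) : Matrix (Fin 3) (Fin 3) ℂ)) ∂ν := rfl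
  rw [hfun] at hg1
  have hcont := hg1.continuousOn_deriv_of_isOpen hU le_rfl
  have hat := (hcont.continuousAt (hU.mem_nhds h0U)).tendsto
  rw [(hasDerivAt_sin_smul_integral_compactWall_zero L α w ν hα hreal h02e Θ hΘ hfc h01 h12).deriv] at hat
  exact hat

end Wall

end Literature.NumberTheory.Automorphic.UnitaryGroup

end
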